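import Mathlib
import HarnessLib
import Summits.PneNP.PneNP.Theorems.OverlapGapAlgebraSearchHardWindowLocalRungCore

/-!
# PneNP / OverlapGapAlgebra — `SearchHardWindow`: occurrence-local rung, one variable pattern

Support for crux `stmt-PneNP-2460` (`Summit.PneNP.PneNP.Theses.OverlapGapAlgebra.SearchHardWindow`),
second file of the OCCURRENCE-LOCAL RUNG (prefix `shwL_`; core counting lemmas in
`…LocalRungCore.lean`, variable-pattern statistics in `…LocalRungPatterns.lean`, assembly and the
verbatim hardness-conjunct corollaries in `…LocalRung.lean`).

Fix the variable pattern `V : slots → variables` (slots `= Fin m × Fin k`) and a solver `A` on the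
sign cube `slots → Bool` that is OCCURRENCE-LOCAL: output bit `v` depends only on the polarities
of the slots carrying `v`. Main result `shwL_card_solved_signs_mul_le_sdr` / `…_mul_le` (`ν = n`):
`#{S : A S ⊨ (V, S)} · (#{clauses with k distinct variables} - ν) ≤ 4^k · kΔ · 2^{mk}` when every
variable has at most `Δ` occurrences and every system of distinct representatives of the clause
hypergraph has at most `ν` slots (so the bound bites exactly when the SDR deficiency is large —
above the 1-orientability density). Ingredients: the pair constraint
(`shwL_card_le_two_mul_add`: an output bit disagrees with one of two of its occurrence polarities
on half the cube, so at most ONE slot per variable is "weak" = disagreement probability `< 1/4`,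
`shwL_card_weak_le`, and the weak slots meet at most `ν` clauses, `shwL_card_clauses_weak_le`),
independence of the `k` disjoint slot blocks of a clause with distinct
variables (`shwL_card_le_four_pow_mul_card_viol`: a clause without weak slots is violated with
probability `≥ 4^{-k}`), independence of variable-disjoint clauses (`shwL_card_inter_viol_mul`),
dependency degree `≤ kΔ` (`shwL_card_rel_le`), and the dependency second moment of the core file.

No definitions; axioms `propext`, `Classical.choice`, `Quot.sound`.
-/

set_option linter.dupNamespace false -- `Summit.PneNP.PneNP.…`: summit = sub-problem (D-0017)

namespace Summit.PneNP.PneNP.Theorems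

open Finset

section Pair

variable {σ : Type*} [Fintype σ] [DecidableEq σ]

/-- On the cube `σ → Bool`, exactly half of the points have different values at two distinct
coordinates `a ≠ b` (the flip of coordinate `a` is a bijection with the other half). -/
theorem shwL_two_mul_card_ne (a b : σ) (hab : a ≠ b) :
    2 * (univ.filter fun S : σ → Bool => S a ≠ S b).card = Fintype.card (σ → Bool) := by
  set φ : (σ → Bool) → (σ → Bool) := fun S => Function.update S a (!S a) with hφ
  have hφa : ∀ S, φ S a = !S a := fun S => by simp [hφ]
  have hφb : ∀ S, φ S b = S b := fun S => by simp [hφ, Function.update_of_ne hab.symm]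
  have hφφ : ∀ S, φ (φ S) = S := by
    intro S
    funext c
    by_cases hc : c = a
    · subst hc; simp [hφ]
    · simp [hφ, Function.update_of_ne hc]
  have heq : (univ.filter fun S : σ → Bool => S a = S b).card
      = (univ.filter fun S : σ → Bool => S a ≠ S b).card := by
    refine card_nbij' φ φ ?_ ?_ (fun S _ => hφφ S) (fun S _ => hφφ S)
    · intro S hS
      simp only [coe_filter, mem_univ, true_and, Set.mem_setOf_eq] at hS ⊢
      rw [hφa, hφb, ← hS]
      cases S a <;> decide
    · intro S hS
      simp only [coe_filter, mem_univ, true_and, Set.mem_setOf_eq] at hS ⊢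
      rw [hφa, hφb]
      revert hS
      cases S a <;> cases S b <;> decide
  have hsum := Finset.card_filter_add_card_filter_not (s := (univ : Finset (σ → Bool)))
    (fun S : σ → Bool => S a = S b)
  rw [card_univ] at hsum
  simp only [ne_eq] at heq ⊢
  omega

/-- **Pair constraint.** For ANY Boolean function `x` of the cube and two distinct coordinates
`a ≠ b`: `#Ω ≤ 2 · (#{S : x S ≠ S a} + #{S : x S ≠ S b})` — `x` disagrees with `S a` or with `S b`
whenever `S a ≠ S b`, which happens on half of the cube. (For the rung: an output bit cannot agree
with two of its occurrence polarities each with probability `> 3/4`.) -/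
theorem shwL_card_le_two_mul_add (x : (σ → Bool) → Bool) (a b : σ) (hab : a ≠ b) :
    Fintype.card (σ → Bool) ≤ 2 * ((univ.filter fun S : σ → Bool => x S ≠ S a).card
      + (univ.filter fun S : σ → Bool => x S ≠ S b).card) := by
  rw [← shwL_two_mul_card_ne a b hab]
  refine Nat.mul_le_mul_left 2 ((card_le_card fun S hS => ?_).trans (card_union_le _ _))
  simp only [mem_filter, mem_univ, true_and, mem_union] at hS ⊢
  by_contra h
  push Not at h
  exact hS (h.1.symm.trans h.2)

end Pair

section Signs

variable {m k n : ℕ}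

/-- **At most `n` weak slots.** Call a slot `a` (a literal position, carrying variable `V a`) WEAK
for the solver `A` (on the sign cube over a fixed variable pattern `V`) if the output bit of its
variable disagrees with the slot's polarity on fewer than a quarter of the sign patterns. By the
pair constraint two slots of the same variable are never both weak, so the weak slots number at
most `n`. (No locality is needed here.) -/
theorem shwL_card_weak_le (V : Fin m × Fin k → Fin n)
    (A : (Fin m × Fin k → Bool) → (Fin n → Bool)) :
    (univ.filter fun a : Fin m × Fin k =>
        4 * (univ.filter fun S : Fin m × Fin k → Bool => A S (V a) ≠ S a).card
          < Fintype.card (Fin m × Fin k → Bool)).card ≤ n := by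
  set W := univ.filter fun a : Fin m × Fin k =>
      4 * (univ.filter fun S : Fin m × Fin k → Bool => A S (V a) ≠ S a).card
        < Fintype.card (Fin m × Fin k → Bool) with hW
  have hinj : Set.InjOn V (W : Set (Fin m × Fin k)) := by
    intro a ha b hb hVab
    rw [hW, coe_filter] at ha hb
    simp only [mem_univ, true_and, Set.mem_setOf_eq] at ha hb
    by_contra hne
    have hpair := shwL_card_le_two_mul_add (fun S : Fin m × Fin k → Bool => A S (V a)) a b hne
    rw [hVab] at ha hpair
    omega
  calc W.card ≤ (univ : Finset (Fin n)).card :=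
        card_le_card_of_injOn V (fun a _ => mem_coe.2 (mem_univ (V a))) hinj
    _ = n := by rw [card_univ, Fintype.card_fin]

/-- **A good clause is violated on at least a `4^{-k}` fraction of the sign cube.** Fix `V` and an
occurrence-local solver `A` (output bit `v` depends only on the polarities of the slots carrying
`v`). If clause `i` has `k` distinct variables and none of its slots is weak, then
`#Ω ≤ 4^k · #{S : every literal of clause i is false under A S}` — the `k` disagreement events are
determined by the pairwise disjoint slot blocks of the `k` variables, hence independent. -/
theorem shwL_card_le_four_pow_mul_card_viol (V : Fin m × Fin k → Fin n)
    (A : (Fin m × Fin k → Bool) → (Fin n → Bool))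
    (hA : ∀ v : Fin n, ∀ S S' : Fin m × Fin k → Bool,
      (∀ a, V a = v → S a = S' a) → A S v = A S' v)
    (i : Fin m) (hinj : Function.Injective fun j : Fin k => V (i, j))
    (hgood : ∀ j : Fin k, Fintype.card (Fin m × Fin k → Bool)
      ≤ 4 * (univ.filter fun S : Fin m × Fin k → Bool => A S (V (i, j)) ≠ S (i, j)).card) :
    Fintype.card (Fin m × Fin k → Bool)
      ≤ 4 ^ k * (univ.filter fun S : Fin m × Fin k → Bool => ∀ j, A S (V (i, j)) ≠ S (i, j)).card := by
  have h := shwL_card_le_pow_mul_card_forall (univ : Finset (Fin k))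
    (fun j => univ.filter fun a : Fin m × Fin k => V a = V (i, j))
    (fun j => univ.filter fun S : Fin m × Fin k → Bool => A S (V (i, j)) ≠ S (i, j))
    (fun j _ S S' hSS' => by
      simp only [mem_filter, mem_univ, true_and] at hSS' ⊢
      rw [hA (V (i, j)) S S' hSS', hSS' (i, j) rfl])
    (fun j _ j' _ hjj' => by
      refine Finset.disjoint_left.2 fun a ha ha' => hjj' (hinj ?_)
      simp only [mem_filter, mem_univ, true_and] at ha ha'
      exact ha.symm.trans ha')
    4 (fun j _ => hgood j)
  rw [card_univ, Fintype.card_fin] at h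
  refine h.trans (le_of_eq ?_)
  congr 2
  ext S
  simp

/-- **Variable-disjoint clauses are independent.** For an occurrence-local solver on a fixed
variable pattern, the violation events of two clauses without a common variable satisfy the
product rule `#(B i ∩ B i') · #Ω = #(B i) · #(B i')`. -/
theorem shwL_card_inter_viol_mul (V : Fin m × Fin k → Fin n)
    (A : (Fin m × Fin k → Bool) → (Fin n → Bool))
    (hA : ∀ v : Fin n, ∀ S S' : Fin m × Fin k → Bool,
      (∀ a, V a = v → S a = S' a) → A S v = A S' v)
    (i i' : Fin m) (h : ∀ j j', V (i, j) ≠ V (i', j')) :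
    ((univ.filter fun S : Fin m × Fin k → Bool => ∀ j, A S (V (i, j)) ≠ S (i, j))
        ∩ (univ.filter fun S : Fin m × Fin k → Bool => ∀ j', A S (V (i', j')) ≠ S (i', j'))).card
        * Fintype.card (Fin m × Fin k → Bool)
      = (univ.filter fun S : Fin m × Fin k → Bool => ∀ j, A S (V (i, j)) ≠ S (i, j)).card
        * (univ.filter fun S : Fin m × Fin k → Bool => ∀ j', A S (V (i', j')) ≠ S (i', j')).card := by
  refine shwL_card_inter_mul_card_of_disjoint
    (univ.filter fun a : Fin m × Fin k => ∃ j, V a = V (i, j))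
    (univ.filter fun a : Fin m × Fin k => ∃ j', V a = V (i', j')) ?_ _ _ ?_ ?_
  · refine Finset.disjoint_left.2 fun a ha ha' => ?_
    simp only [mem_filter, mem_univ, true_and] at ha ha'
    obtain ⟨j, hj⟩ := ha
    obtain ⟨j', hj'⟩ := ha'
    exact h j j' (hj.symm.trans hj')
  · intro S S' hSS'
    simp only [mem_filter, mem_univ, true_and] at hSS' ⊢
    refine forall_congr' fun j => ?_
    rw [hA (V (i, j)) S S' fun a ha => hSS' a ⟨j, ha⟩, hSS' (i, j) ⟨j, rfl⟩]
  · intro S S' hSS'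
    simp only [mem_filter, mem_univ, true_and] at hSS' ⊢
    refine forall_congr' fun j' => ?_
    rw [hA (V (i', j')) S S' fun a ha => hSS' a ⟨j', ha⟩, hSS' (i', j') ⟨j', rfl⟩]

/-- **Dependency degree.** If every variable occurs in at most `Δ` slots of `V`, then a clause
shares a variable with at most `k · Δ` clauses (of any set `G`). -/
theorem shwL_card_rel_le (V : Fin m × Fin k → Fin n) (Δ : ℕ)
    (hΔ : ∀ v : Fin n, (univ.filter fun a : Fin m × Fin k => V a = v).card ≤ Δ)
    (i : Fin m) (G : Finset (Fin m)) :
    (G.filter fun i' => ∃ j j', V (i, j) = V (i', j')).card ≤ k * Δ := by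
  have hsub : (G.filter fun i' => ∃ j j', V (i, j) = V (i', j'))
      ⊆ (univ : Finset (Fin k)).biUnion fun j =>
          (univ.filter fun a : Fin m × Fin k => V a = V (i, j)).image Prod.fst := by
    intro i' hi'
    simp only [mem_filter] at hi'
    obtain ⟨-, j, j', hjj'⟩ := hi'
    simp only [mem_biUnion, mem_univ, true_and, mem_image, mem_filter]
    exact ⟨j, (i', j'), hjj'.symm, rfl⟩
  calc (G.filter fun i' => ∃ j j', V (i, j) = V (i', j')).card
      ≤ ∑ j : Fin k, ((univ.filter fun a : Fin m × Fin k => V a = V (i, j)).image Prod.fst).card :=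
        (card_le_card hsub).trans card_biUnion_le
    _ ≤ ∑ _j : Fin k, Δ := sum_le_sum fun j _ => card_image_le.trans (hΔ _)
    _ = k * Δ := by rw [sum_const, card_univ, Fintype.card_fin, smul_eq_mul]

/-- Arithmetic of the final step of `shwL_card_solved_signs_mul_le` (kept separate so that `ring`
never meets the large `Fintype.card` atoms): from `dist ≤ g`, `g·N ≤ F·s`,
`sol·s ≤ N²·KD` and `N > 0` conclude `sol · dist ≤ F · KD · N`. -/
theorem shwL_combine_aux {sol dist g N s F KD : ℕ} (hN : 0 < N) (h2 : dist ≤ g)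
    (h3 : g * N ≤ F * s) (h4 : sol * s ≤ N ^ 2 * KD) : sol * dist ≤ F * KD * N := by
  refine Nat.le_of_mul_le_mul_right ?_ hN
  calc sol * dist * N ≤ sol * g * N := Nat.mul_le_mul_right _ (Nat.mul_le_mul_left _ h2)
    _ = sol * (g * N) := by ring
    _ ≤ sol * (F * s) := Nat.mul_le_mul_left _ h3
    _ = F * (sol * s) := by ring
    _ ≤ F * (N ^ 2 * KD) := Nat.mul_le_mul_left _ h4
    _ = F * KD * N * N := by ring

/-- **Weak slots hit at most `ν` clauses**, where `ν` bounds the size of every system of distinct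
representatives of the clause hypergraph (a set of slots carrying pairwise distinct variables and
lying in pairwise distinct clauses): the weak slots carry distinct variables (`shwL_card_weak_le`'s
injectivity), so one weak slot per clause met is such a system. With `ν = n` this is the trivial
bound; above the 1-orientability density `ν` is the matching number of the hypergraph. -/
theorem shwL_card_clauses_weak_le (V : Fin m × Fin k → Fin n)
    (A : (Fin m × Fin k → Bool) → (Fin n → Bool)) (ν : ℕ)
    (hν : ∀ W : Finset (Fin m × Fin k), Set.InjOn V (W : Set (Fin m × Fin k)) →
      Set.InjOn Prod.fst (W : Set (Fin m × Fin k)) → W.card ≤ ν) :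
    ((univ.filter fun a : Fin m × Fin k =>
        4 * (univ.filter fun S : Fin m × Fin k → Bool => A S (V a) ≠ S a).card
          < Fintype.card (Fin m × Fin k → Bool)).image Prod.fst).card ≤ ν := by
  set W := univ.filter fun a : Fin m × Fin k =>
      4 * (univ.filter fun S : Fin m × Fin k → Bool => A S (V a) ≠ S a).card
        < Fintype.card (Fin m × Fin k → Bool) with hW
  -- the weak slots carry pairwise distinct variables (pair constraint)
  have hinj : Set.InjOn V (W : Set (Fin m × Fin k)) := by
    intro a ha b hb hVab
    rw [hW, coe_filter] at ha hb
    simp only [mem_univ, true_and, Set.mem_setOf_eq] at ha hb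
    by_contra hne
    have hpair := shwL_card_le_two_mul_add (fun S : Fin m × Fin k → Bool => A S (V a)) a b hne
    rw [hVab] at ha hpair
    omega
  -- one weak slot per clause met: a system of distinct representatives
  obtain ⟨u, huW, hinj1, himg⟩ := Finset.exists_subset_injOn_image_eq_of_surjOn
    (f := (Prod.fst : Fin m × Fin k → Fin m)) (W : Set (Fin m × Fin k)) (W.image Prod.fst)
    (by rw [Set.SurjOn, coe_image])
  calc (W.image Prod.fst).card = (u.image Prod.fst).card := by rw [himg]
    _ = u.card := card_image_of_injOn hinj1
    _ ≤ ν := hν u (hinj.mono huW) hinj1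

end Signs

section SignsMain

/-- **Occurrence-local rung, one variable pattern.** Fix the variable pattern
`V : slots → variables` of an instance with `m` clauses of width `k` over `n` variables, in which
every variable occurs at most `Δ` times, and let `A` be an OCCURRENCE-LOCAL solver on the sign
cube: output bit `v` of `A S` depends only on the polarities `S a` of the slots `a` carrying `v`
(and arbitrarily on `V`); let `ν` bound every system of distinct representatives of the clause
hypergraph (`ν = n` always works; above the 1-orientability density `ν` = matching number). Then
`#{S : A S satisfies (V, S)} · (#{clauses with k distinct variables} - ν) ≤ 4^k · kΔ · 2^{mk}`.
Proof: the weak slots (pair constraint) meet at most `ν` clauses, so at least `#distinct - ν`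
clauses are good; each is
violated on `≥ 4^{-k}` of the cube (independence over its `k` disjoint slot blocks); clauses
without a common variable are independent and each clause meets `≤ kΔ` others; conclude by the
second-moment inequality `Pr[no good clause violated] · E[#violated] ≤ kΔ`. -/
theorem shwL_card_solved_signs_mul_le_sdr {m k n : ℕ} (V : Fin m × Fin k → Fin n)
    (A : (Fin m × Fin k → Bool) → (Fin n → Bool))
    (hA : ∀ v : Fin n, ∀ S S' : Fin m × Fin k → Bool,
      (∀ a, V a = v → S a = S' a) → A S v = A S' v)
    (Δ : ℕ) (hΔ : ∀ v : Fin n, (univ.filter fun a : Fin m × Fin k => V a = v).card ≤ Δ) (ν : ℕ)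
    (hν : ∀ W : Finset (Fin m × Fin k), Set.InjOn V (W : Set (Fin m × Fin k)) →
      Set.InjOn Prod.fst (W : Set (Fin m × Fin k)) → W.card ≤ ν) :
    (univ.filter fun S : Fin m × Fin k → Bool => ∀ i : Fin m, ∃ j : Fin k, A S (V (i, j)) = S (i, j)).card
        * ((univ.filter fun i : Fin m => Function.Injective fun j : Fin k => V (i, j)).card - ν)
      ≤ 4 ^ k * (k * Δ) * Fintype.card (Fin m × Fin k → Bool) := by
  have hNpos : 0 < Fintype.card (Fin m × Fin k → Bool) := Fintype.card_pos
  -- weak slots `W`, good clauses `G`, violation events `B` (kept opaque)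
  obtain ⟨W, hW⟩ : ∃ W : Finset (Fin m × Fin k), W = univ.filter fun a : Fin m × Fin k =>
      4 * (univ.filter fun S : Fin m × Fin k → Bool => A S (V a) ≠ S a).card
        < Fintype.card (Fin m × Fin k → Bool) := ⟨_, rfl⟩
  have hWν : (W.image Prod.fst).card ≤ ν := hW ▸ shwL_card_clauses_weak_le V A ν hν
  obtain ⟨G, hG⟩ : ∃ G : Finset (Fin m), G = univ.filter fun i : Fin m =>
      (Function.Injective fun j : Fin k => V (i, j)) ∧ ∀ j, (i, j) ∉ W := ⟨_, rfl⟩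
  obtain ⟨B, hB⟩ : ∃ B : Fin m → Finset (Fin m × Fin k → Bool), B = fun i =>
      univ.filter fun S : Fin m × Fin k → Bool => ∀ j, A S (V (i, j)) ≠ S (i, j) := ⟨_, rfl⟩
  have hDistG : (univ.filter fun i : Fin m => Function.Injective fun j : Fin k => V (i, j)).card - ν
      ≤ G.card := by
    have hsub : (univ.filter fun i : Fin m => Function.Injective fun j : Fin k => V (i, j))
        ⊆ G ∪ W.image Prod.fst := by
      intro i hi
      rw [mem_filter] at hi
      by_cases hw : ∀ j, (i, j) ∉ W
      · exact mem_union_left _ (by rw [hG, mem_filter]; exact ⟨mem_univ _, hi.2, hw⟩)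
      · push Not at hw
        obtain ⟨j, hj⟩ := hw
        exact mem_union_right _ (mem_image.2 ⟨(i, j), hj, rfl⟩)
    have := (card_le_card hsub).trans ((card_union_le _ _).trans
      (Nat.add_le_add_left hWν _))
    omega
  -- second moment over the good clauses (dependency = sharing a variable), applied to the set of
  -- solved sign patterns: a solved sign pattern violates no clause, in particular no good one
  have hmom := shwL_card_zero_mul_sum_le G B (fun i i' => ∃ j j', V (i, j) = V (i', j')) (k * Δ)
    (fun i _ => by convert shwL_card_rel_le V Δ hΔ i G)
    (fun i _ i' _ hrel => by
      have hrel' : ∀ j j', V (i, j) ≠ V (i', j') := fun j j' h => hrel ⟨j, j', h⟩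
      subst hB
      exact le_of_eq (shwL_card_inter_viol_mul V A hA i i' hrel'))
    (univ.filter fun S : Fin m × Fin k → Bool => ∀ i : Fin m, ∃ j : Fin k, A S (V (i, j)) = S (i, j))
    (fun S hS i _ => by
      simp only [mem_filter, mem_univ, true_and] at hS
      simp only [hB, mem_filter, mem_univ, true_and, not_forall, not_not]
      exact hS i)
  -- the expected number of violated good clauses is at least `#G / 4^k`
  have hexp : G.card * Fintype.card (Fin m × Fin k → Bool) ≤ 4 ^ k * ∑ i ∈ G, (B i).card := by
    rw [mul_sum, ← smul_eq_mul]
    refine card_nsmul_le_sum G _ _ fun i hi => ?_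
    rw [hG, mem_filter] at hi
    rw [hB]
    refine shwL_card_le_four_pow_mul_card_viol V A hA i hi.2.1 fun j => ?_
    have hj := hi.2.2 j
    rw [hW, mem_filter, not_and] at hj
    exact not_lt.1 (hj (mem_univ _))
  -- combine and cancel one factor `#Ω`
  exact shwL_combine_aux hNpos hDistG hexp hmom

/-- **Occurrence-local rung, one variable pattern (`ν = n`).** As `shwL_card_solved_signs_mul_le_sdr`
with the trivial bound: a system of distinct representatives has at most `n` slots (its slots
carry distinct variables). This is the registered form used downstream (`α > 1`). -/
theorem shwL_card_solved_signs_mul_le {m k n : ℕ} (V : Fin m × Fin k → Fin n)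
    (A : (Fin m × Fin k → Bool) → (Fin n → Bool))
    (hA : ∀ v : Fin n, ∀ S S' : Fin m × Fin k → Bool,
      (∀ a, V a = v → S a = S' a) → A S v = A S' v)
    (Δ : ℕ) (hΔ : ∀ v : Fin n, (univ.filter fun a : Fin m × Fin k => V a = v).card ≤ Δ) :
    (univ.filter fun S : Fin m × Fin k → Bool => ∀ i : Fin m, ∃ j : Fin k, A S (V (i, j)) = S (i, j)).card
        * ((univ.filter fun i : Fin m => Function.Injective fun j : Fin k => V (i, j)).card - n)
      ≤ 4 ^ k * (k * Δ) * Fintype.card (Fin m × Fin k → Bool) :=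
  shwL_card_solved_signs_mul_le_sdr V A hA Δ hΔ n fun W hW _ =>
    calc W.card ≤ (univ : Finset (Fin n)).card :=
        card_le_card_of_injOn V (fun a _ => mem_coe.2 (mem_univ (V a))) hW
      _ = n := by rw [card_univ, Fintype.card_fin]

end SignsMain

end Summit.PneNP.PneNP.Theorems
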